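import Summits.CriticalPhenomena.SAWScalingLimit.Theorems.SAWDevelopingMapHexConjectureFarSideTriangleTail
import HarnessLib

/-!
# Crux `HexConjecture` (stmt-CriticalPhenomena-0808), line `root-locality-replaces-loewner` (lead c8):
the arch aspect bound follows from a WINDOW TWO-POINT LOWER BOUND

Landing target:
`Summits/CriticalPhenomena/SAWScalingLimit/Theorems/SAWDevelopingMapHexConjectureAspectBoundOfWindowTwoPoint.lean`
(`--supports stmt-CriticalPhenomena-0808`; registered stub `stub_archAspectBound_of_windowTwoPointLowerBound`).

Seat c6 reshaped the lever of the line to the ARCH ASPECT BOUND AAB (skeleton statement 2♮,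
`Cruxes/HexConjecture/Lines/root_locality_replaces_loewner.lean`): one constant `C` such that for all small inner
windows `[θ₁R, θa R]` the far (reach-`R`) `x_c`-mass of the critical arches `s_x → t_{x+d e₀}` of any finite `Λ` above the
floor, summed over the inner window, is at most `C` times the two-point mass `Σ_{d ∈ [θa R, θb R]} Z_{B_R}(s_x → t_d)` of
the reference window in the upper half-box `B_R`.  By `farArchMass_offsetSum_le_sub_triA` (file
`…FarSideTriangleTail.lean`) the far side is at most the triangle tail `1/cos(3π/8) − A^Δ(⌊R/4⌋) = 2(cos(π/8)/cos(3π/8))·triDl ⌊R/4⌋`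
WHATEVER `Λ`, `θ₁` and the inner window are.  Hence AAB follows from the

  WINDOW TWO-POINT LOWER BOUND (WTLB):  `∃ 0 < θa < θb ≤ 1/4, C, R₀: ∀ R ≥ R₀ ∀ x:
      triDl ⌊R/4⌋ ≤ C · Σ_{d ∈ [θa R, θb R]} Z_{B_R(x)}(s_x → t_{x + d e₀})`

— a one-scale comparison of the reference-window boundary two-point mass of the half-box with the explicit
non-increasing sequence `triDl` (Glazman–Manolescu's `Σ_K Δ^Δ_{L,K}`, Krachun–Panagiotis's `D_{2L+1}/2`), with no domain
`Λ`, no inner window and no far-mass functional (`archAspectBound_of_windowTwoPointLowerBound`).  Status of WTLB: its CUBE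
version `triDl(4⌊R/40⌋)³ ≤ Σ_{d ∈ [R/40, R/4]} Z_{B_R}(s_x → t_d)` is a theorem (GM's gluing, `…WindowMassCube.lean`); the linear
version is Krachun–Panagiotis 2023 Cor. 3.1 (confined form) plus LOWER REGULARITY of `D_T` (`Σ_{i≤3T} D_i ≤ C T D_{18T}`), open.
Sources: GlazmanManolescu2019 (Lemma 4.1, §4.1), arXiv:2310.17299 (Lemma 2.2, Cor. 3.1), DuminilCopinSmirnov2012 (Lemma 2).
-/

noncomputable section

open scoped BigOperators Topology Classical
open Filter Set
open Literature.Probability.LatticeModels (HexVertex hexGraph hexCenter Site)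
open Literature.Probability.RandomPlanarGeometry
open Literature.Probability.RandomPlanarGeometry.SAW
open Literature.Probability.RandomPlanarGeometry.SAW.HV
open Summit.CriticalPhenomena.SAWScalingLimit.Theorems.ObservableToSLE.FloorRatio

namespace Summit.CriticalPhenomena.SAWScalingLimit.Theorems.HexConjecture.RootLocality


/-- **THE ARCH ASPECT BOUND FROM THE WINDOW TWO-POINT LOWER BOUND.**  If for some `0 < θa < θb ≤ 1/4`, `C` and all
large `R` the reference-window two-point mass of the upper half-box dominates the triangle tail,
`triDl ⌊R/4⌋ ≤ C Σ_{d ∈ [θa R, θb R]} Z_{B_R}(s_x → t_{x+d e₀})`, then the arch aspect bound (skeleton statement 2♮ of the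
line, verbatim) holds with the same `θa, θb` and the constant `2(cos(π/8)/cos(3π/8))·C`: the far side is at most
`1/cos(3π/8) − A^Δ(⌊R/4⌋) = 2(cos(π/8)/cos(3π/8))·triDl ⌊R/4⌋` for `R ≥ 9` (`3⌊R/4⌋ + 2 < R`), uniformly in `Λ`, `θ₁` and the
inner window. [cite: GlazmanManolescu2019, Lemma 4.1; DuminilCopinSmirnov2012, Lemma 2 and §3] -/
theorem archAspectBound_of_windowTwoPointLowerBound
    (hW : ∃ θa θb C : ℝ, 0 < θa ∧ θa < θb ∧ θb ≤ 1 / 4 ∧ 0 < C ∧ ∃ R₀ : ℝ, 0 < R₀ ∧ ∀ R : ℝ, R₀ ≤ R →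
      ∀ (x : Site 2) (B : Finset HexVertex) (S' : Finset ℤ),
        (∀ v : HexVertex, v ∈ B ↔ (x 1 ≤ v.1 1 ∧
          dist (hexCenter v) (hexMidpoint s((x - Pi.single 1 1, 1), (x, 0))) ≤ R)) →
        (∀ d : ℤ, d ∈ S' ↔ (θa * R ≤ (d : ℝ) ∧ (d : ℝ) ≤ θb * R)) →
        triDl ⌊R / 4⌋₊ ≤ C * ∑ d ∈ S', ∑ γ : HexMidEdgeSAW B s((x - Pi.single 1 1, 1), (x, 0))
            s((x + Pi.single 0 d - Pi.single 1 1, 1), (x + Pi.single 0 d, 0)), hexCriticalFugacity ^ γ.length) :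
    ∃ θa θb C : ℝ, 0 < θa ∧ θa < θb ∧ θb ≤ 1 / 4 ∧ 0 < C ∧ ∀ θ₁ : ℝ, 0 < θ₁ → θ₁ < θa →
      ∃ R₀ : ℝ, 0 < R₀ ∧ ∀ R : ℝ, R₀ ≤ R →
      ∀ (x : Site 2) (Λ B : Finset HexVertex) (S S' : Finset ℤ),
        (∀ v ∈ Λ, x 1 ≤ v.1 1) →
        (∀ v : HexVertex, v ∈ B ↔ (x 1 ≤ v.1 1 ∧
          dist (hexCenter v) (hexMidpoint s((x - Pi.single 1 1, 1), (x, 0))) ≤ R)) →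
        (∀ d : ℤ, d ∈ S ↔ (θ₁ * R ≤ (d : ℝ) ∧ (d : ℝ) ≤ θa * R)) →
        (∀ d : ℤ, d ∈ S' ↔ (θa * R ≤ (d : ℝ) ∧ (d : ℝ) ≤ θb * R)) →
        ∑ d ∈ S, (∑ γ : HexMidEdgeSAW Λ s((x - Pi.single 1 1, 1), (x, 0))
            s((x + Pi.single 0 d - Pi.single 1 1, 1), (x + Pi.single 0 d, 0)),
          if ∃ v ∈ γ.verts, R ≤ dist (hexCenter v) (hexMidpoint s((x - Pi.single 1 1, 1), (x, 0)))
          then hexCriticalFugacity ^ γ.length else 0) ≤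
        C * ∑ d ∈ S', ∑ γ : HexMidEdgeSAW B s((x - Pi.single 1 1, 1), (x, 0))
            s((x + Pi.single 0 d - Pi.single 1 1, 1), (x + Pi.single 0 d, 0)), hexCriticalFugacity ^ γ.length := by
  obtain ⟨θa, θb, C, hθa, hab, hb, hC, R₀, hR₀, hW⟩ := hW
  set κ : ℝ := Real.cos (Real.pi / 8) / Real.cos (3 * Real.pi / 8) with hκ
  have hκ0 : 0 < κ := div_pos cos_pi_div_eight_pos cos_three_pi_div_eight_pos
  refine ⟨θa, θb, 2 * κ * C, hθa, hab, hb, by positivity, fun θ₁ hθ₁ _ => ?_⟩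
  refine ⟨max R₀ 9, lt_max_of_lt_left hR₀, fun R hR x Λ B S S' hΛ hB hS hS' => ?_⟩
  have hRR₀ : R₀ ≤ R := le_trans (le_max_left _ _) hR
  have hR9 : (9 : ℝ) ≤ R := le_trans (le_max_right _ _) hR
  have hRpos : 0 < R := by linarith
  -- `0 ∉ S`: the inner window starts at `θ₁ R > 0`
  have hS0 : (0 : ℤ) ∉ S := by
    intro h0
    have h := ((hS 0).1 h0).1
    simp only [Int.cast_zero] at h
    linarith [mul_pos hθ₁ hRpos]
  -- the scale of the triangle: `L = ⌊R/4⌋`, `3L + 2 < R`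
  set L : ℕ := ⌊R / 4⌋₊ with hL
  have hL4 : (L : ℝ) ≤ R / 4 := Nat.floor_le (by linarith)
  have hLR : 3 * (L : ℝ) + 2 < R := by linarith
  -- far side ≤ triangle tail ≤ `2κ C ×` reference mass
  have hfar := farArchMass_offsetSum_le_sub_triA x Λ hΛ S hS0 L R hLR
  have hwin := hW R hRR₀ x B S' hB hS'
  have hZ : 0 ≤ ∑ d ∈ S', ∑ γ : HexMidEdgeSAW B s((x - Pi.single 1 1, 1), (x, 0))
      s((x + Pi.single 0 d - Pi.single 1 1, 1), (x + Pi.single 0 d, 0)), hexCriticalFugacity ^ γ.length :=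
    Finset.sum_nonneg fun d _ => archMass_nonneg _ _ _
  calc _ ≤ (Real.cos (3 * Real.pi / 8))⁻¹ - triA L := hfar
    _ = 2 * κ * triDl L := by rw [inv_cos_sub_triA_eq_two_mul L, hκ]
    _ ≤ 2 * κ * (C * ∑ d ∈ S', ∑ γ : HexMidEdgeSAW B s((x - Pi.single 1 1, 1), (x, 0))
          s((x + Pi.single 0 d - Pi.single 1 1, 1), (x + Pi.single 0 d, 0)), hexCriticalFugacity ^ γ.length) :=
        mul_le_mul_of_nonneg_left hwin (by positivity)
    _ = 2 * κ * C * _ := by ring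

/-- **Registered stub `stub_archAspectBound_of_windowTwoPointLowerBound`** (crux item stmt-CriticalPhenomena-0808, line
`root-locality-replaces-loewner`, lead c8): the window two-point lower bound implies the arch aspect bound (skeleton
statement 2♮, verbatim) — `archAspectBound_of_windowTwoPointLowerBound`.
[cite: GlazmanManolescu2019, Lemma 4.1; DuminilCopinSmirnov2012, Lemma 2 and §3] -/
theorem stub_archAspectBound_of_windowTwoPointLowerBound :
    (∃ θa θb C : ℝ, 0 < θa ∧ θa < θb ∧ θb ≤ 1 / 4 ∧ 0 < C ∧ ∃ R₀ : ℝ, 0 < R₀ ∧ ∀ R : ℝ, R₀ ≤ R → ∀ (x : Literature.Probability.LatticeModels.Site 2) (B : Finset Literature.Probability.LatticeModels.HexVertex) (S' : Finset ℤ), (∀ v : Literature.Probability.LatticeModels.HexVertex, v ∈ B ↔ (x 1 ≤ v.1 1 ∧ dist (Literature.Probability.LatticeModels.hexCenter v) (Literature.Probability.RandomPlanarGeometry.SAW.hexMidpoint s((x - Pi.single 1 1, 1), (x, 0))) ≤ R)) → (∀ d : ℤ, d ∈ S' ↔ (θa * R ≤ (d : ℝ) ∧ (d : ℝ) ≤ θb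 * R)) → Literature.Probability.RandomPlanarGeometry.SAW.HV.triDl ⌊R / 4⌋₊ ≤ C * ∑ d ∈ S', ∑ γ : Literature.Probability.RandomPlanarGeometry.SAW.HexMidEdgeSAW B s((x - Pi.single 1 1, 1), (x, 0)) s((x + Pi.single 0 d - Pi.single 1 1, 1), (x + Pi.single 0 d, 0)), Literature.Probability.RandomPlanarGeometry.SAW.hexCriticalFugacity ^ γ.length) → (∃ θa θb C : ℝ, 0 < θa ∧ θa < θb ∧ θb ≤ 1 / 4 ∧ 0 < C ∧ ∀ θ₁ : ℝ, 0 < θ₁ → θ₁ < θa → ∃ R₀ : ℝ, 0 < R₀ ∧ ∀ R : ℝ, R₀ ≤ R → ∀ (x : Literature.Probability.LatticeModels.Site 2) (Λ B : Finset Literature.Probability.LatticeModels.HexVertex) (S S' : Finset ℤ), (∀ v ∈ Λ, x 1 ≤ v.1 1) → (∀ v : Literature.Probability.LatticeModels.HexVertex, v ∈ B ↔ (x 1 ≤ v.1 1 ∧ dist (Literature.Probability.LatticeModels.hexCenter v) (Literature.Probability.RandomPlanarGeometry.SAW.hexMidpoint s((x - Pi.single 1 1, 1), (x, 0))) ≤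 R)) → (∀ d : ℤ, d ∈ S ↔ (θ₁ * R ≤ (d : ℝ) ∧ (d : ℝ) ≤ θa * R)) → (∀ d : ℤ, d ∈ S' ↔ (θa * R ≤ (d : ℝ) ∧ (d : ℝ) ≤ θb * R)) → ∑ d ∈ S, (∑ γ : Literature.Probability.RandomPlanarGeometry.SAW.HexMidEdgeSAW Λ s((x - Pi.single 1 1, 1), (x, 0)) s((x + Pi.single 0 d - Pi.single 1 1, 1), (x + Pi.single 0 d, 0)), if ∃ v ∈ γ.verts, R ≤ dist (Literature.Probability.LatticeModels.hexCenter v) (Literature.Probability.RandomPlanarGeometry.SAW.hexMidpoint s((x - Pi.single 1 1, 1), (x, 0))) then Literature.Probability.RandomPlanarGeometry.SAW.hexCriticalFugacity ^ γ.length else 0) ≤ C * ∑ d ∈ S', ∑ γ : Literature.Probability.RandomPlanarGeometry.SAW.HexMidEdgeSAW B s((x - Pi.single 1 1, 1), (x, 0)) s((x + Pi.single 0 d - Pi.single 1 1, 1), (x + Pi.single 0 d, 0)), Literature.Probability.RandomPlanarGeometry.SAW.hexCriticalFugacity ^ γ.length) :=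
  fun hW => archAspectBound_of_windowTwoPointLowerBound hW

end Summit.CriticalPhenomena.SAWScalingLimit.Theorems.HexConjecture.RootLocality

end
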